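import Summits.AtomisticToContinuum.Crystallization.Theses.PricedLinkCensus
import Summits.AtomisticToContinuum.Crystallization.Theorems.ChargedEnergyGap.Negative.NoBoundaryReduction
import Summits.AtomisticToContinuum.Crystallization.Theorems.ChargedEnergyGap.Negative.PeriodicMinimisers
import Summits.AtomisticToContinuum.Crystallization.Theorems.ChargedEnergyGap.Negative.BarlowBlind
import Literature.MathematicalPhysics.StatisticalMechanics.LocalMatchingCompactness
import Literature.MathematicalPhysics.StatisticalMechanics.BarlowStacking
import HarnessLib

/-!
# Line `defect-zoom-compactness` for crux `ChargedEnergyGap` (stmt-AtomisticToContinuum-14231) — lead's skeleton (c1)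

Crux (route `PricedLinkCensus`, rank 3): `∃ κ > 0, ∃ C, ∀ N, ∀ injective y : Fin N → ℝ³,
N·e* + κ·#charged(1/100, y) − C·N^(2/3) ≤ E_LJ(y)`.  By the landed negative lemma
`chargedEnergyGap_iff_noBoundary` (Negative II) the allowance `C` is not load-bearing, so the crux is
`∃ κ > 0, NoBoundary (1/100) κ`: every finite injective configuration pays `κ` per charged site above
`N·e*` (`e* = ⨅_Q e_LJ(Q)`, `ChargedEnergyGapNegative.eStar`).

THE LINE (planner's card `Lines/defect-zoom-compactness.md`): prove the priced gap by CONTRADICTION AND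
COMPACTNESS, zooming on the CHEAPEST defect.

* `stub_hardCoreReduction` (M, provable now) — it suffices to price charge in `1/4`-separated configurations.
* `stub_defectZoom` (L/XL) — if the hard-core priced gap fails for every `κ > 0`: violators `yₙ` with
  excess per charged site `→ 0`; pre-heal them by sparse local surgery (so local limits are Sütő
  ground-state configurations at `μ = e*`); root them at the charged site minimising the nearest-charge
  cluster excess `T(i)` (`Σ_i T(i) = E − N·e*` exactly, so `min T ≤ (E − N e*)/#charged → 0`); pass to a
  local limit (`exists_subseq_forall_eventually_ballMatch`, `δ = 1/4`).  Output: a `1/4`-separated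
  `e*`-GSC `Y ∋ 0`, a set `D ∋ 0` of defect-or-threshold points of `Y`, and the nearest-`D` cell of `0`
  is CHEAP.  Its own hard step (far-cell signed bound) imports effective soft layer propagation (14233).
* `stub_cheapDefectRootIsBarlow` (XL, hardest; the lead's) — LIOUVILLE: a hard-core `e*`-GSC rooted at a
  defect-or-threshold point with cheap cell is, on `B(0, 6a)`, `a/800`-close to an ideal Barlow
  stacking.  Carries the qualitative energetic-crystallization content (no exotic zero-excess `e*`-GSC).
* `stub_barlowMargin` (M, geometry, provable now) — local Barlow-closeness forbids a defect-or-threshold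
  root (the `ε = a/800` perturbation of the landed `isChargeFree_barlowStacking`, Negative IX).
* `ChargedEnergyGap_of` — the kernel-checked composition (no `sorry` outside the four `stub_*`).

STATUS (lead c1, end of cycle 1, 2026-08-16): stubs 1 and 4 LANDED (p98945 + `chargedEnergyGap_iff_hardCore` p101237; p97640);
stub 2 blocked (14233, 9334, e(word) = e*; Cheap mechanism of the planner unsound — see its docstring); stub 3 crux-sized.

RESHAPE (lead c1, 2026-08-16): the planner's `let`-inlined stub statements are replaced by FULLY INLINED,
FULLY QUALIFIED ONE-LINE signatures (a registered signature must survive textual restatement in a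
`Theorems/`-side `--supports` file; a `let … :=` inside the signature does not), and the readable local
names `HC`, `siteExcess`, `Defect`, `Cheap`, `BarlowLoc`, `HCGap` are now `def`s of this namespace, each
DEFINITIONALLY the inlined text (`*_holds` below are `:= stub_*`).  Mathematical content unchanged.
`IsMuGSC` / `BallMatch` are those of `Literature/…/MuGroundStateConfiguration.lean` (via
`LocalMatchingCompactness`), NOT the homonymous `MuGSC.lean` (never import both).

Disproof.lean (gen 3) used: `chargedEnergyGap_iff_noBoundary` is the frame; `η = 1/100 > 0` enters
quantitatively in `stub_barlowMargin` (bond lengths `≤ 1.0025a < 1.01·0.9975a`), honouring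
`not_gapWith_of_eta_nonpos`; injectivity is load-bearing (`not_gapNonInj`) and is strengthened to a hard
core by `stub_hardCoreReduction`; Negative IX (`isChargeFree_barlowStacking`) is the `ε = 0` case of
`stub_barlowMargin`; Negative VIII (`chargedEnergyGap_iff_kappaMax_pos`): the line shows
`κ_max(1/100) > 0` without computing it.
-/

noncomputable section

namespace Summit.AtomisticToContinuum.Crystallization.Cruxes.ChargedEnergyGap.DefectZoomCompactness

open Literature.MathematicalPhysics.StatisticalMechanics
open Literature.Geometry.DiscreteGeometry
open Summit.AtomisticToContinuum.Crystallization.Theses.PricedLinkCensus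
open Summit.AtomisticToContinuum.Crystallization.Theorems.ChargedEnergyGapNegative
  (E3 eStar charged NoBoundary chargedEnergyGap_iff_noBoundary)
open scoped BigOperators

/-! ## Objects of the line (readable local names; the registered stubs inline them verbatim) -/

/-- Hard core `1/4`: distinct points of `Y` are at least `1/4` apart. -/
def HC (Y : Set E3) : Prop := ∀ p ∈ Y, ∀ q ∈ Y, p ≠ q → (1 / 4 : ℝ) ≤ dist p q

/-- Site excess `w_Y(p) = ½ Σ_{q ≠ p} V_LJ(|p − q|) − e*` (half-pair site energy above `e*`; `tsum`). -/
def siteExcess (Y : Set E3) (p : Y) : ℝ :=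
  (1 / 2 : ℝ) * (∑' q : {q : Y // q ≠ p}, lennardJones (dist (p : E3) (q.1 : E3))) - eStar

/-- `q` is a DEFECT-OR-THRESHOLD point of `Y`: charged at `1/100` in `Y`, or two points of `Y` within
`3·nn_q` of `q` sit exactly at the bond threshold `dist = 1.01·min(nn, nn)` (closure of "charged" under
local convergence). -/
def Defect (Y : Set E3) (q : Y) : Prop :=
  ¬ IsChargeFree (1 / 100 : ℝ) (Subtype.val : Y → E3) q ∨
    ∃ p p' : Y, p ≠ p' ∧ dist (p : E3) q ≤ 3 * nearestDist (Subtype.val : Y → E3) q ∧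
      dist (p' : E3) q ≤ 3 * nearestDist (Subtype.val : Y → E3) q ∧
      dist (p : E3) p' = (1 + 1 / 100) *
        min (nearestDist (Subtype.val : Y → E3) p) (nearestDist (Subtype.val : Y → E3) p')

/-- The nearest-`D` cell of `0` is CHEAP: for every `ε > 0` and arbitrarily large `R` some tie-break `S`
of the cell inside `‖·‖ ≤ R` (strict cell ⊆ S ⊆ closed cell) has `Σ_{p ∈ S} w_Y(p) ≤ ε`. -/
def Cheap (Y : Set E3) (D : Set Y) : Prop :=
  ∀ ε : ℝ, 0 < ε → ∀ R₀ : ℝ, ∃ R : ℝ, R₀ ≤ R ∧ ∃ S : Finset Y,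
    (∀ p ∈ S, ‖(p : E3)‖ ≤ R ∧ ∀ q ∈ D, ‖(p : E3)‖ ≤ dist (p : E3) q) ∧
    (∀ p : Y, ‖(p : E3)‖ ≤ R → (∀ q ∈ D, (q : E3) ≠ 0 → ‖(p : E3)‖ < dist (p : E3) q) → p ∈ S) ∧
    ∑ p ∈ S, siteExcess Y p ≤ ε

/-- `Y` is LOCALLY BARLOW at `0`: two-way `a/800`-matched on `B(0, 6a)` with a rigid image of an ideal
Barlow stacking `barlowStacking a (a√(2/3)) s` (`s` any Hägg word), and `a/2`-separated there. -/
def BarlowLoc (Y : Set E3) : Prop :=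
  ∃ a : ℝ, 0 < a ∧ ∃ s : ℤ → ℤ, IsHaggSeq s ∧ ∃ g : E3 ≃ᵃⁱ[ℝ] E3,
    BallMatch (a / 800) (6 * a) 0 Y (g '' barlowStacking a (a * Real.sqrt (2 / 3)) s) ∧
    ∀ p ∈ Y, ∀ q ∈ Y, ‖p‖ ≤ 6 * a → ‖q‖ ≤ 6 * a → p ≠ q → a / 2 ≤ dist p q

/-- The HARD-CORE priced gap: a price `κ > 0` per charged site above `N·e*`, no boundary allowance, on
`1/4`-separated injective configurations. -/
def HCGap : Prop :=
  ∃ κ : ℝ, 0 < κ ∧ ∀ (N : ℕ) (y : Fin N → E3), Function.Injective y →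
    (∀ i j : Fin N, i ≠ j → (1 / 4 : ℝ) ≤ dist (y i) (y j)) →
    (N : ℝ) * eStar + κ * (charged (1 / 100) y : ℝ) ≤ interactionEnergy lennardJones y

/-! ## Registered stubs (sorries live ONLY here; signatures fully inlined and qualified, one line each) -/

/-- **STUB 1 — hard-core reduction** (S; LANDED p98945 `Theorems/PricedLinkCensusChargedEnergyGapHardCoreReduction.lean`, decl `…Theorems.DefectZoomCompactnessHardCore.stub_hardCoreReduction`).  `HCGap → ∃ κ > 0, NoBoundary (1/100) κ`.
Cheapest proof (lead c1): `1/3`-separated ⇒ `1/4`-separated and injective, so `HCGap` gives the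
separated priced charge gap relative to `e = e*` with `C = 0`, which the LANDED
`BarlowRelativePricingRegularise.stub_regularise` (p86708; hypothesis = the LANDED recount
`BarlowRelativePricingRecount.stub_chargeRecount`, p85951) lifts to all injective configurations with an
allowance `C·N^(2/3)`; that is `ChargedEnergyGap` verbatim (`chargedEnergyGap_iff`, `charged`, `eStar`
unfold by `rfl`), and `chargedEnergyGap_iff_noBoundary` removes the allowance.  (Planner's alternative:
re-insert crowded points far away as isolated atoms.) -/
theorem stub_hardCoreReduction : (∃ κ : ℝ, 0 < κ ∧ ∀ (N : ℕ) (y : Fin N → EuclideanSpace ℝ (Fin 3)), Function.Injective y → (∀ i j : Fin N, i ≠ j → (1 / 4 : ℝ) ≤ dist (y i) (y j)) → (N : ℝ) * Summit.AtomisticToContinuum.Crystallization.Theorems.ChargedEnergyGapNegative.eStar + κ * (Summit.AtomisticToContinuum.Crystallization.Theorems.ChargedEnergyGapNegative.charged (1 / 100) y : ℝ) ≤ Literature.MathematicalPhysics.StatisticalMechanics.interactionEnergy Literature.MathematicalPhysics.StatisticalMechanics.lennardJones y) → ∃ κ : ℝ, 0 < κ ∧ Summit.AtomisticToContinuum.Crystallization.Theorems.ChargedEnergyGapNegative.NoBoundary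 (1 / 100) κ := by
  -- LANDED p98945: `Summit.AtomisticToContinuum.Crystallization.Theorems.DefectZoomCompactnessHardCore.stub_hardCoreReduction`
  -- (kept as `sorry` in this published copy only while the farm has no olean for the fresh module; the lead's
  -- work/ChargedEnergyGap.lean imports it and defines this stub by that declaration)
  sorry

/-- **STUB 2 — the defect zoom** (size XL; wave-1 worker verdict 2026-08-16: `stub-blocked` — statement audited and
kept, NOT provable with tree material; analysis attached to the item as `StubDefectZoom-analysis.md`).  If the
hard-core priced gap fails for every `κ > 0`, some `1/4`-separated Sütő ground-state configuration of Lennard-Jones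
at `μ = e*` (`IsMuGSC lennardJones eStar Y`) contains `0` and a set `D ∋ 0` of defect-or-threshold points such
that the nearest-`D` cell of `0` is cheap.  PROVABLE NOW (≈ 2 kloc, nothing of it in the tree; healed-violator
analogue of the open item 13685 `MuGSCLimitExtraction`): violators (`card_mul_eStar_le`, `excess_nonneg`);
HEALING by finite descent on the excess `F ≥ 0` (each sparse local surgery gains `≥ γₙ`, flips `≤ C(Rₙ)` charges,
so with `γₙ = 2C(Rₙ)κₙ → 0` at least half the charged sites survive); rooting at a surviving charged site;
COMPACTNESS (`exists_subseq_forall_eventually_ballMatch`, `δ = 1/4`) for the configurations and the charged sets;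
energy transfer under matching with hard-core `r⁻⁶` tails; the HC-reduction `isMuGSC_of_stable_strict` (an
inserted point at distance `d ≤ 1/4` has field `≥ d⁻⁶(d⁻⁶/12 − 251/6) > 0 > e*`); the THRESHOLD LEMMA (a local
limit of charged sites is `Defect`); hence `HC Y ∧ IsMuGSC lennardJones eStar Y ∧ root ∈ D ∧ ∀ q ∈ D, Defect Y q`.
NOT PROVABLE NOW — `Cheap`: (i) the planner's mechanism (argmin of the nearest-charge cluster excess `T` plus a
FAR-CELL SIGNED BOUND `Σ_{cell ∖ B_R}(e_p − e*) ≥ −ε(R)`) is UNSOUND: across a (001) plane of zero-pressure fcc the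
normal-stress first moment is `M₁ ≈ 0.30 ≠ 0` (worker numerics), so a strain kink of slope `s` on a closed surface
of area `A` moves signed excess `≈ 0.15·A·s` across it at elastic cost `O(s²A)` — an `O(1)` inflow into the root
cell at vanishing cost, no charge created; (ii) the surviving route bounds the root cell by the gain of the REFILL
surgery after healing, `Σ_{|p−root| ≤ R}(e_p − e*) ≤ γₙ + misfit_n(R) + |B_R|·(e(ambient Hägg word) − e*)`, and
needs, in order, `PricedLinkCensus.SoftLayerPropagation` (stmt-AtomisticToContinuum-14233, OPEN), a rigidity
upgrade (matching ⇒ small strain, uncatalogued), `ExcessDecayLiouville.ExcessDecay` (stmt-…-9334, OPEN), and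
`e(ambient word) = e*` — energetic optimality of the ambient Barlow stacking, i.e. crystallization content again.
So this stub, like stub 3, is crux-sized beyond its provable compactness core. -/
theorem stub_defectZoom : ¬ (∃ κ : ℝ, 0 < κ ∧ ∀ (N : ℕ) (y : Fin N → EuclideanSpace ℝ (Fin 3)), Function.Injective y → (∀ i j : Fin N, i ≠ j → (1 / 4 : ℝ) ≤ dist (y i) (y j)) → (N : ℝ) * Summit.AtomisticToContinuum.Crystallization.Theorems.ChargedEnergyGapNegative.eStar + κ * (Summit.AtomisticToContinuum.Crystallization.Theorems.ChargedEnergyGapNegative.charged (1 / 100) y : ℝ) ≤ Literature.MathematicalPhysics.StatisticalMechanics.interactionEnergy Literature.MathematicalPhysics.StatisticalMechanics.lennardJones y) → ∃ (Y : Set (EuclideanSpace ℝ (Fin 3))) (h0 : (0 : EuclideanSpace ℝ (Fin 3)) ∈ Y) (D : Set ↥Y), (∀ p ∈ Y, ∀ q ∈ Y, p ≠ q → (1 / 4 : ℝ) ≤ dist p q) ∧ Literature.MathematicalPhysics.StatisticalMechanics.IsMuGSC Literature.MathematicalPhysics.StatisticalMechanics.lennardJones Summit.AtomisticToContinuum.Crystallization.Theorems.ChargedEnergyGapNegative.eStar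 Y ∧ (⟨0, h0⟩ : ↥Y) ∈ D ∧ (∀ q ∈ D, (¬ Literature.Geometry.DiscreteGeometry.IsChargeFree (1 / 100 : ℝ) (Subtype.val : ↥Y → EuclideanSpace ℝ (Fin 3)) q ∨ ∃ p p' : ↥Y, p ≠ p' ∧ dist (p : EuclideanSpace ℝ (Fin 3)) q ≤ 3 * Literature.Geometry.DiscreteGeometry.nearestDist (Subtype.val : ↥Y → EuclideanSpace ℝ (Fin 3)) q ∧ dist (p' : EuclideanSpace ℝ (Fin 3)) q ≤ 3 * Literature.Geometry.DiscreteGeometry.nearestDist (Subtype.val : ↥Y → EuclideanSpace ℝ (Fin 3)) q ∧ dist (p : EuclideanSpace ℝ (Fin 3)) p' = (1 + 1 / 100) * min (Literature.Geometry.DiscreteGeometry.nearestDist (Subtype.val : ↥Y → EuclideanSpace ℝ (Fin 3)) p) (Literature.Geometry.DiscreteGeometry.nearestDist (Subtype.val : ↥Y → EuclideanSpace ℝ (Fin 3)) p'))) ∧ (∀ ε : ℝ, 0 < ε → ∀ R₀ : ℝ, ∃ R : ℝ, R₀ ≤ R ∧ ∃ S : Finset ↥Y, (∀ p ∈ S,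 ‖(p : EuclideanSpace ℝ (Fin 3))‖ ≤ R ∧ ∀ q ∈ D, ‖(p : EuclideanSpace ℝ (Fin 3))‖ ≤ dist (p : EuclideanSpace ℝ (Fin 3)) q) ∧ (∀ p : ↥Y, ‖(p : EuclideanSpace ℝ (Fin 3))‖ ≤ R → (∀ q ∈ D, (q : EuclideanSpace ℝ (Fin 3)) ≠ 0 → ‖(p : EuclideanSpace ℝ (Fin 3))‖ < dist (p : EuclideanSpace ℝ (Fin 3)) q) → p ∈ S) ∧ ∑ p ∈ S, ((1 / 2 : ℝ) * (∑' q : {q : ↥Y // q ≠ p}, Literature.MathematicalPhysics.StatisticalMechanics.lennardJones (dist (p : EuclideanSpace ℝ (Fin 3)) (q.1 : EuclideanSpace ℝ (Fin 3)))) - Summit.AtomisticToContinuum.Crystallization.Theorems.ChargedEnergyGapNegative.eStar) ≤ ε) := by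
  sorry

/-- **STUB 3 — Liouville / rigidity for cheap-rooted `e*`-GSCs** (size XL; THE HARDEST, the lead's;
carries the qualitative crystallization content).  A `1/4`-separated `e*`-GSC of Lennard-Jones rooted
at a defect-or-threshold point whose nearest-defect cell is cheap is, on `B(0, 6a)`, two-way
`a/800`-matched to a rigid image of an ideal Barlow stacking (and `a/2`-separated there).  Why plausibly
true: the known hard-core `e*`-GSCs are optimal close packings with UNHEALABLE defects only — facets at
coexistence `μ = e*`, grain boundaries, dislocations — and every one of them is cell-EXPENSIVE; vacancies,
interstitials, threshold pinches and stacking faults are healable, hence not GSC; an exotic zero-excess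
GSC (Frank–Kasper-like, amorphous) would violate the stub — this is where energetic crystallization hides.
Stacking-blind: any Hägg word `s` is allowed.  No witness against it can be certified either: the
hypothesis `IsMuGSC lennardJones eStar Y` is not checkable for any explicit `Y` without `e*` from below. -/
theorem stub_cheapDefectRootIsBarlow : ∀ (Y : Set (EuclideanSpace ℝ (Fin 3))) (h0 : (0 : EuclideanSpace ℝ (Fin 3)) ∈ Y) (D : Set ↥Y), (∀ p ∈ Y, ∀ q ∈ Y, p ≠ q → (1 / 4 : ℝ) ≤ dist p q) → Literature.MathematicalPhysics.StatisticalMechanics.IsMuGSC Literature.MathematicalPhysics.StatisticalMechanics.lennardJones Summit.AtomisticToContinuum.Crystallization.Theorems.ChargedEnergyGapNegative.eStar Y → (⟨0, h0⟩ : ↥Y) ∈ D → (∀ q ∈ D, (¬ Literature.Geometry.DiscreteGeometry.IsChargeFree (1 / 100 : ℝ) (Subtype.val : ↥Y → EuclideanSpace ℝ (Fin 3)) q ∨ ∃ p p' : ↥Y, p ≠ p' ∧ dist (p : EuclideanSpace ℝ (Fin 3)) q ≤ 3 * Literature.Geometry.DiscreteGeometry.nearestDist (Subtype.val : ↥Y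 → EuclideanSpace ℝ (Fin 3)) q ∧ dist (p' : EuclideanSpace ℝ (Fin 3)) q ≤ 3 * Literature.Geometry.DiscreteGeometry.nearestDist (Subtype.val : ↥Y → EuclideanSpace ℝ (Fin 3)) q ∧ dist (p : EuclideanSpace ℝ (Fin 3)) p' = (1 + 1 / 100) * min (Literature.Geometry.DiscreteGeometry.nearestDist (Subtype.val : ↥Y → EuclideanSpace ℝ (Fin 3)) p) (Literature.Geometry.DiscreteGeometry.nearestDist (Subtype.val : ↥Y → EuclideanSpace ℝ (Fin 3)) p'))) → (∀ ε : ℝ, 0 < ε → ∀ R₀ : ℝ, ∃ R : ℝ, R₀ ≤ R ∧ ∃ S : Finset ↥Y, (∀ p ∈ S, ‖(p : EuclideanSpace ℝ (Fin 3))‖ ≤ R ∧ ∀ q ∈ D, ‖(p : EuclideanSpace ℝ (Fin 3))‖ ≤ dist (p : EuclideanSpace ℝ (Fin 3)) q) ∧ (∀ p : ↥Y, ‖(p : EuclideanSpace ℝ (Fin 3))‖ ≤ R → (∀ q ∈ D, (q : EuclideanSpace ℝ (Fin 3)) ≠ 0 → ‖(p : EuclideanSpace ℝ (Fin 3))‖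 < dist (p : EuclideanSpace ℝ (Fin 3)) q) → p ∈ S) ∧ ∑ p ∈ S, ((1 / 2 : ℝ) * (∑' q : {q : ↥Y // q ≠ p}, Literature.MathematicalPhysics.StatisticalMechanics.lennardJones (dist (p : EuclideanSpace ℝ (Fin 3)) (q.1 : EuclideanSpace ℝ (Fin 3)))) - Summit.AtomisticToContinuum.Crystallization.Theorems.ChargedEnergyGapNegative.eStar) ≤ ε) → (∃ a : ℝ, 0 < a ∧ ∃ s : ℤ → ℤ, Literature.MathematicalPhysics.StatisticalMechanics.IsHaggSeq s ∧ ∃ g : EuclideanSpace ℝ (Fin 3) ≃ᵃⁱ[ℝ] EuclideanSpace ℝ (Fin 3), Literature.MathematicalPhysics.StatisticalMechanics.BallMatch (a / 800) (6 * a) 0 Y (g '' Literature.MathematicalPhysics.StatisticalMechanics.barlowStacking a (a * Real.sqrt (2 / 3)) s) ∧ ∀ p ∈ Y, ∀ q ∈ Y, ‖p‖ ≤ 6 * a → ‖q‖ ≤ 6 * a → p ≠ q → a / 2 ≤ dist p q) := by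
  sorry

/-- **STUB 4 — margin lemma** (M; LANDED p97640 `Theorems/PricedLinkCensusChargedEnergyGapBarlowMargin.lean`, decl `…Theorems.DefectZoomCompactnessBarlowMargin.stub_barlowMargin`, 396 lines, general index type).  If `Y` is two-way
`a/800`-matched on `B(0, 6a)` to `g '' barlowStacking a (a√(2/3)) s` and `a/2`-separated there, then
`0` is charge-free in `Y` at tolerance `1/100` and no pair within `3·nn_0` sits at the threshold:
matched points move by `≤ a/800`, pair distances by `≤ a/400`; the twelve first neighbours lie in
`[0.9975a, 1.0025a]`, so `dist ≤ 1.0025a < 1.01·0.9975a = 1.007475a ≤ 1.01·min(nn, nn)` (bonded,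
strictly); every other pair has `dist ≥ √2·a − a/400 > 1.41a > 1.0126a ≥ 1.01·min(nn, nn)` (not
bonded, strictly: the ideal distance spectrum is `{1, √2, √(8/3), √3, …}·a`, `eq_or_dist_eq_of_dist_lt`,
`le_dist_of_mem_barlowStacking`); ring numbers are those of the ideal contact graph, `= 4`
(`ncard_commonTouching_eq_four`); template: the landed `BarlowRelativePricingDetect` (p84788). -/
theorem stub_barlowMargin : ∀ (Y : Set (EuclideanSpace ℝ (Fin 3))) (h0 : (0 : EuclideanSpace ℝ (Fin 3)) ∈ Y), (∃ a : ℝ, 0 < a ∧ ∃ s : ℤ → ℤ, Literature.MathematicalPhysics.StatisticalMechanics.IsHaggSeq s ∧ ∃ g : EuclideanSpace ℝ (Fin 3) ≃ᵃⁱ[ℝ] EuclideanSpace ℝ (Fin 3), Literature.MathematicalPhysics.StatisticalMechanics.BallMatch (a / 800) (6 * a) 0 Y (g '' Literature.MathematicalPhysics.StatisticalMechanics.barlowStacking a (a * Real.sqrt (2 / 3)) s) ∧ ∀ p ∈ Y, ∀ q ∈ Y, ‖p‖ ≤ 6 * a → ‖q‖ ≤ 6 * a → p ≠ q → a / 2 ≤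 dist p q) → ¬ (¬ Literature.Geometry.DiscreteGeometry.IsChargeFree (1 / 100 : ℝ) (Subtype.val : ↥Y → EuclideanSpace ℝ (Fin 3)) (⟨0, h0⟩ : ↥Y) ∨ ∃ p p' : ↥Y, p ≠ p' ∧ dist (p : EuclideanSpace ℝ (Fin 3)) (⟨0, h0⟩ : ↥Y) ≤ 3 * Literature.Geometry.DiscreteGeometry.nearestDist (Subtype.val : ↥Y → EuclideanSpace ℝ (Fin 3)) (⟨0, h0⟩ : ↥Y) ∧ dist (p' : EuclideanSpace ℝ (Fin 3)) (⟨0, h0⟩ : ↥Y) ≤ 3 * Literature.Geometry.DiscreteGeometry.nearestDist (Subtype.val : ↥Y → EuclideanSpace ℝ (Fin 3)) (⟨0, h0⟩ : ↥Y) ∧ dist (p : EuclideanSpace ℝ (Fin 3)) p' = (1 + 1 / 100) * min (Literature.Geometry.DiscreteGeometry.nearestDist (Subtype.val : ↥Y → EuclideanSpace ℝ (Fin 3)) p) (Literature.Geometry.DiscreteGeometry.nearestDist (Subtype.val : ↥Y → EuclideanSpace ℝ (Fin 3)) p')) := by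
  -- LANDED p97640: `Summit.AtomisticToContinuum.Crystallization.Theorems.DefectZoomCompactnessBarlowMargin.stub_barlowMargin`
  -- (kept as `sorry` in this published copy only while the farm has no olean for the fresh module)
  sorry

/-! ### Consistency: each readable statement IS its registered stub (definitionally) -/

theorem hardCoreReduction_holds : HCGap → ∃ κ : ℝ, 0 < κ ∧ NoBoundary (1 / 100) κ :=
  stub_hardCoreReduction

theorem defectZoom_holds :
    ¬ HCGap → ∃ (Y : Set E3) (h0 : (0 : E3) ∈ Y) (D : Set Y),
      HC Y ∧ IsMuGSC lennardJones eStar Y ∧ (⟨0, h0⟩ : Y) ∈ D ∧ (∀ q ∈ D, Defect Y q) ∧ Cheap Y D :=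
  stub_defectZoom

theorem cheapDefectRootIsBarlow_holds :
    ∀ (Y : Set E3) (h0 : (0 : E3) ∈ Y) (D : Set Y),
      HC Y → IsMuGSC lennardJones eStar Y → (⟨0, h0⟩ : Y) ∈ D → (∀ q ∈ D, Defect Y q) →
        Cheap Y D → BarlowLoc Y :=
  stub_cheapDefectRootIsBarlow

theorem barlowMargin_holds : ∀ (Y : Set E3) (h0 : (0 : E3) ∈ Y), BarlowLoc Y → ¬ Defect Y ⟨0, h0⟩ :=
  stub_barlowMargin

/-! ## The composition (kernel-checked, no `sorry` outside the stubs) -/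

/-- **Core of the composition**: the four stubs imply the no-boundary priced gap
`∃ κ > 0, NoBoundary (1/100) κ`.  Logic: if it fails then (stub 1) the hard-core gap fails, so
(stub 2) a cheap-rooted defective hard-core `e*`-GSC exists, which (stub 3) is locally Barlow at the
root, contradicting (stub 4) the defect at the root. -/
theorem noBoundary_of_line : ∃ κ : ℝ, 0 < κ ∧ NoBoundary (1 / 100) κ := by
  by_contra hneg
  have hHC : ¬ HCGap := fun h => hneg (hardCoreReduction_holds h)
  obtain ⟨Y, h0, D, hY, hG, hroot, hdef, hcheap⟩ := defectZoom_holds hHC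
  exact barlowMargin_holds Y h0 (cheapDefectRootIsBarlow_holds Y h0 D hY hG hroot hdef hcheap)
    (hdef _ hroot)

/-- **`defect-zoom-compactness` — the crux BY NAME from the registered stubs.**  The kernel checks
here that the composition reaches the route decl `PricedLinkCensus.ChargedEnergyGap`
(`chargedEnergyGap_iff_noBoundary`, landed Negative II); the only `sorry`s in its cone are the four
stubs. -/
theorem ChargedEnergyGap_of :
    Summit.AtomisticToContinuum.Crystallization.Theses.PricedLinkCensus.ChargedEnergyGap :=
  chargedEnergyGap_iff_noBoundary.2 noBoundary_of_line

end Summit.AtomisticToContinuum.Crystallization.Cruxes.ChargedEnergyGap.DefectZoomCompactness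

end
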